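import Literature.AlgebraicGeometry.Motives.ProjTwistDictionary
import Literature.AlgebraicGeometry.Motives.CechPointwiseFamily
import Literature.AlgebraicGeometry.Motives.FunctionFieldOver
import Literature.AlgebraicGeometry.Morphisms.SeparatedAffinePreimage
import Literature.Algebra.Homology.LaurentCechEvalSpan
import HarnessLib

/-!
# The pointwise family of `𝒪_Z(dH)` on an integral closed `Z ⊆ 𝐏ⁿ_A` and its sections over
# `π⁻¹U ∩ Z_{ℓ_t}` for a morphism `π : Z → V` to a separated `A`-scheme

Continuing `Motives/ProjTwistDictionary` (twisted linear coordinates `ℓ_j`, units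
`θ_j = ℓ_j/x_{a₀} ∈ K(Z)`): the stalks of the invertible sheaf `𝒪_Z(dH)`, `H = V₊(x_{a₀})`, as a
POINTWISE FAMILY `ProjTwist.Pd d : Z → Submodule A K(Z)` in the sense of
`Motives/CechPointwiseFamily` (`z ∈ Pd d y` iff `θ_j^{-d} z ∈ 𝒪_{Z,y}` for the charts `Z_{ℓ_j} ∋ y`;
one chart suffices, `mem_Pd_iff_of_mem`, the ratios `θ_j/θ_k` being units on `Z_{ℓ_j} ∩ Z_{ℓ_k}`), and:

* `ProjTwist.secs_Pd_eq_evFam` — **`Γ(Z_{ℓ_t}, 𝒪_Z(dH)) = evFam A θ 1 0 d t`** inside `K(Z)`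
  (`t ≠ ∅`; the dictionary `ProjTwist.mem_evFam_iff`);
* `ProjTwist.secs_Pd_preimage_inf_eq` — for `π : Z → V` dominant to an integral `A`-scheme `V`
  separated over `Spec A` (compatibly with `ι : Z → 𝐏ⁿ_A`) and an affine open `U ⊆ V`,
  **`Γ(π⁻¹U ∩ Z_{ℓ_t}, 𝒪_Z(dH)) = evFam Γ(U, 𝒪_V) θ 1 0 d t`**: the sections over the affine
  `π⁻¹U ∩ Z_{ℓ_t}` are generated by `Γ(U, 𝒪_V)` and `Γ(Z_{ℓ_t}, 𝒪)`
  (`SeparatedAffinePreimage.exists_sum_res_mul_appLE`, the graph of `π` being closed) and the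
  evaluated family commutes with the change of base ring (`LaurentCech.evFam_eq_span_evFam`).

With `LaurentCech.exists_forall_exactAt_evCplx` over the Noetherian rings `Γ(U, 𝒪_V)` the second
identity is the relative Serre vanishing `R^iπ_*𝒪_Z(d)|_U = 0` (`i ≥ 1`, `d ≫ 0`) in Čech form for a
Chow cover (Görtz–Wedhorn II, Thm. 23.1 (2) and proof of Thm. 23.17, p. 425).

Everything is proved; no named facts.

## References

* U. Görtz, T. Wedhorn, *Algebraic Geometry II* (2023): Thm. 22.22, Thm. 23.1, Thm. 23.17
  (pp. 336, 412, 424–425). [GortzWedhorn2023]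
* U. Görtz, T. Wedhorn, *Algebraic Geometry I*, 2nd ed. (2020): (13.6)–(13.8), Prop. 9.15.
  [GortzWedhorn2020]
-/

noncomputable section

open CategoryTheory AlgebraicGeometry TopologicalSpace Opposite HomogeneousLocalization
open Literature.Algebra.Homology Literature.Algebra.Homology.LaurentCech
open Literature.AlgebraicGeometry.Morphisms Literature.AlgebraicGeometry.Morphisms.ProjCech
open Literature.AlgebraicGeometry.Motives.RatFn Literature.AlgebraicGeometry.Motives.ProjFrac

universe u

attribute [local instance] MvPolynomial.gradedAlgebra
  Literature.AlgebraicGeometry.Motives.ProjBaseChange.algebraBase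

namespace Literature.AlgebraicGeometry.Motives

namespace ProjTwist

variable {A : Type u} [CommRing A] {n : ℕ}

/-! ### Units at a point: integer powers -/

/-- Units at a point are closed under integer powers. [folklore] -/
theorem _root_.Literature.AlgebraicGeometry.Motives.RatFn.IsUnitAt.zpow {X : Scheme.{u}}
    [IsIntegral X] {x : X} {h : X.functionField} (hh : IsUnitAt x h) (d : ℤ) : IsUnitAt x (h ^ d) := by
  obtain ⟨m, rfl | rfl⟩ := Int.eq_nat_or_neg d
  · rw [zpow_natCast]; exact hh.pow m
  · rw [zpow_neg, zpow_natCast]; exact (hh.pow m).inv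

/-! ### The pointwise family of `𝒪_Z(dH)` -/

section Pd

variable {Z : Scheme.{u}} [IsIntegral Z] (ι : Z ⟶ PP A n) (c : Fin (n + 1) → A) (a₀ : Fin (n + 1))
  (ha₀ : genericPoint Z ∈ ZH ι (MvPolynomial.X a₀)) (hℓ : ∀ j, genericPoint Z ∈ ZH ι (ell c a₀ j))

/-- `x_{a₀}(x/x_{a₀}) = 1`. [folklore] -/
theorem dehomFn_X_self : dehomFn ι a₀ ha₀ (MvPolynomial.X a₀) = 1 := by
  rw [dehomFn, RingHom.comp_apply, dehomAway, RingHom.comp_apply, AlgHom.toRingHom_eq_coe,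
    AlgHom.toRingHom_eq_coe, RingHom.coe_coe, RingHom.coe_coe, ProjectiveSpace.dehomogenize_X_self,
    map_one, map_one]

/-- **`θ_j⁻¹ = x_{a₀}/ℓ_j` is regular on `Z_{ℓ_j}`.** [folklore] -/
theorem isRegularAt_theta_inv {j : Fin (n + 1)} {y : Z} (hy : y ∈ ZH ι (ell c a₀ j)) :
    IsRegularAt y (theta ι c a₀ ha₀ j)⁻¹ := by
  have hG : MvPolynomial.X a₀ ∈ grading A n (1 • 1) := by simpa using ProjectiveSpace.X_mem (R := A) a₀
  have key := fracFn_mk_eq_div ι ha₀ (ell_mem c a₀ j) one_pos (genericPoint_mem_of_mem hy) 1 hG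
  rw [pow_one, dehomFn_X_self, one_div] at key
  rw [theta, ← key]
  exact isRegularAt_fracFn ι _ hy _

include hℓ in
/-- **The ratios `θ_j/θ_k` are units on `Z_{ℓ_j} ∩ Z_{ℓ_k}`** (the transition functions of
`𝒪_Z(H)`). [folklore] -/
theorem isUnitAt_theta_div {j k : Fin (n + 1)} {y : Z} (hyj : y ∈ ZH ι (ell c a₀ j))
    (hyk : y ∈ ZH ι (ell c a₀ k)) : IsUnitAt y (theta ι c a₀ ha₀ j / theta ι c a₀ ha₀ k) := by
  have hreg : ∀ {j k : Fin (n + 1)}, y ∈ ZH ι (ell c a₀ k) →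
      IsRegularAt y (theta ι c a₀ ha₀ j / theta ι c a₀ ha₀ k) := fun {j k} hyk => by
    have hG : ell c a₀ j ∈ grading A n (1 • 1) := by simpa using ell_mem c a₀ j
    have key := fracFn_mk_eq_div ι ha₀ (ell_mem c a₀ k) one_pos (genericPoint_mem_of_mem hyk) 1 hG
    rw [pow_one] at key
    rw [theta, theta, ← key]
    exact isRegularAt_fracFn ι _ hyk _
  rw [isUnitAt_iff]
  refine ⟨div_ne_zero (isUnit_theta ι c a₀ ha₀ hℓ j).ne_zero (isUnit_theta ι c a₀ ha₀ hℓ k).ne_zero,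
    hreg hyk, ?_⟩
  rw [inv_div]
  exact hreg hyj

variable [Algebra A Z.functionField]
  (hAreg : ∀ (a : A) (y : Z), IsRegularAt y (algebraMap A Z.functionField a))

/-- **The stalk of `𝒪_Z(dH)` at `y` inside `K(Z)`**: the rational functions `z` with `θ_j^{-d} z`
regular at `y` for every chart `Z_{ℓ_j} ∋ y` (`H = V₊(x_{a₀})`, local equations `θ_j⁻¹ = x_{a₀}/ℓ_j`;
Görtz–Wedhorn I, (11.9)/(13.8)), an `A`-submodule (`A` acting by everywhere-regular functions,
`hAreg`). [cite: GortzWedhorn2020, (13.8) (p. 395)] -/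
def Pd (d : ℤ) (y : Z) : Submodule A Z.functionField where
  carrier := {z | ∀ j, y ∈ ZH ι (ell c a₀ j) → IsRegularAt y ((theta ι c a₀ ha₀ j ^ d)⁻¹ * z)}
  zero_mem' := fun j _ => by rw [mul_zero]; exact isRegularAt_zero
  add_mem' := fun hz hw j hj => by rw [mul_add]; exact (hz j hj).add (hw j hj)
  smul_mem' := fun a z hz j hj => by
    rw [Algebra.smul_def, mul_left_comm]
    exact (hAreg a y).mul (hz j hj)

/-- Membership in `Pd`. [folklore] -/
theorem mem_Pd_iff {d : ℤ} {y : Z} {z : Z.functionField} :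
    z ∈ Pd ι c a₀ ha₀ hAreg d y ↔
      ∀ j, y ∈ ZH ι (ell c a₀ j) → IsRegularAt y ((theta ι c a₀ ha₀ j ^ d)⁻¹ * z) := Iff.rfl

include hℓ in
/-- **One chart suffices**: for `y ∈ Z_{ℓ_k}`, `z ∈ Pd d y` iff `θ_k^{-d} z ∈ 𝒪_{Z,y}`. [folklore] -/
theorem mem_Pd_iff_of_mem {d : ℤ} {y : Z} {k : Fin (n + 1)} (hyk : y ∈ ZH ι (ell c a₀ k))
    {z : Z.functionField} :
    z ∈ Pd ι c a₀ ha₀ hAreg d y ↔ IsRegularAt y ((theta ι c a₀ ha₀ k ^ d)⁻¹ * z) := by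
  refine ⟨fun h => h k hyk, fun h j hyj => ?_⟩
  have hu := (isUnitAt_theta_div ι c a₀ ha₀ hℓ hyk hyj).zpow d
  have e : (theta ι c a₀ ha₀ j ^ d)⁻¹ * z =
      (theta ι c a₀ ha₀ k / theta ι c a₀ ha₀ j) ^ d * ((theta ι c a₀ ha₀ k ^ d)⁻¹ * z) := by
    have hk0 : theta ι c a₀ ha₀ k ^ d ≠ 0 := zpow_ne_zero d (isUnit_theta ι c a₀ ha₀ hℓ k).ne_zero
    rw [div_zpow]
    field_simp
  rw [e]
  exact hu.isRegularAt.mul h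

/-- `Pd d y` is stable under multiplication by functions regular at `y`. [folklore] -/
theorem isRegularAt_mul_mem_Pd {d : ℤ} {y : Z} {g z : Z.functionField} (hg : IsRegularAt y g)
    (hz : z ∈ Pd ι c a₀ ha₀ hAreg d y) : g * z ∈ Pd ι c a₀ ha₀ hAreg d y := fun j hj => by
  rw [mul_left_comm]
  exact hg.mul (hz j hj)

/-- `1 ∈ Pd d y` for `d ≥ 0` (`θ_j⁻¹` is regular on `Z_{ℓ_j}`). [folklore] -/
theorem one_mem_Pd {d : ℤ} (hd : 0 ≤ d) (y : Z) : (1 : Z.functionField) ∈ Pd ι c a₀ ha₀ hAreg d y := by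
  intro j hj
  obtain ⟨m, rfl⟩ := Int.eq_ofNat_of_zero_le hd
  rw [mul_one, zpow_natCast, ← inv_pow]
  exact (isRegularAt_theta_inv ι c a₀ ha₀ hj).pow m

include hℓ in
/-- `Pd` is principal on each chart `Z_{ℓ_k}`: generated by `θ_k^d`. [folklore] -/
theorem exists_principal_Pd (d : ℤ) (k : Fin (n + 1)) :
    ∃ φ : Z.functionField, ∀ y ∈ ZH ι (ell c a₀ k), ∀ z,
      z ∈ Pd ι c a₀ ha₀ hAreg d y ↔ IsRegularAt y (φ * z) :=
  ⟨(theta ι c a₀ ha₀ k ^ d)⁻¹, fun _ hy _ => mem_Pd_iff_of_mem ι c a₀ ha₀ hℓ hAreg hy⟩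

omit [IsIntegral Z] [Algebra A Z.functionField] in
/-- `⋂_{j ∈ t} Z_{ℓ_j} = Z_{ℓ_t}`. [folklore] -/
theorem finset_inf_ZH_ell (t : Finset (Fin (n + 1))) :
    t.inf (fun j => ZH ι (ell c a₀ j)) = ZH ι (α c a₀ (Xs A t)) := by
  classical
  rw [Xs, map_prod]
  induction t using Finset.induction_on with
  | empty => rw [Finset.inf_empty, Finset.prod_empty, ZH_one]
  | insert a t hat ih => rw [Finset.inf_insert, Finset.prod_insert hat, ZH_mul, ih, α_X]

variable (hc : c a₀ = 0)
  (hA : ∀ a : A, algebraMap A Z.functionField a =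
    ofSection (U := ⊤) (Set.mem_univ _) ((ι ≫ toSpec A n).appTop ((Scheme.ΓSpecIso (.of A)).inv a)))

omit hAreg in
include hA in
/-- Under `hA`, scalars are regular everywhere. [folklore] -/
theorem isRegularAt_algebraMap_of_hA (a : A) (y : Z) : IsRegularAt y (algebraMap A Z.functionField a) := by
  rw [hA]
  exact isRegularAt_ofSection (Set.mem_univ y) _

include hc hℓ hA in
/-- **`Γ(Z_{ℓ_t}, 𝒪_Z(dH)) = evFam A θ 1 0 d t`** inside `K(Z)` (`t ≠ ∅`): the sections of the
pointwise family `Pd d` over `Z_{ℓ_t}` are the evaluated family of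
`Literature/Algebra/Homology/LaurentCechEvalSes` (`ProjTwist.mem_evFam_iff`).
[cite: GortzWedhorn2020, (13.6)–(13.8) (pp. 391–395)] -/
theorem secs_Pd_eq_evFam [IsClosedImmersion ι] {t : Finset (Fin (n + 1))} (ht : t.Nonempty) (d : ℤ) :
    PtFamily.secs (Pd ι c a₀ ha₀ hAreg d) (ZH ι (α c a₀ (Xs A t))) =
      evFam A (theta ι c a₀ ha₀) (isUnit_theta ι c a₀ ha₀ hℓ) (fun _ : Unit => (1 : Z.functionField))
        (0 : Unit → ℤ) d t := by
  obtain ⟨k, hk⟩ := ht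
  ext z
  rw [PtFamily.mem_secs, mem_evFam_iff ι c a₀ hc ha₀ hℓ hA ⟨k, hk⟩ hk]
  refine ⟨fun h y hy => ?_, fun h y hy => ?_⟩
  · exact (mem_Pd_iff_of_mem ι c a₀ ha₀ hℓ hAreg (ZH_α_Xs_le ι c a₀ hk hy)).1 (h y hy)
  · exact (mem_Pd_iff_of_mem ι c a₀ ha₀ hℓ hAreg (ZH_α_Xs_le ι c a₀ hk hy)).2 (h y hy)

end Pd

/-! ### Sections over `π⁻¹U ∩ Z_{ℓ_t}` for `π : Z → V`, `V` separated over `Spec A` -/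

section Preimage

variable {Z : Scheme.{u}} [IsIntegral Z] (ι : Z ⟶ PP A n) [IsClosedImmersion ι]
  (c : Fin (n + 1) → A) (a₀ : Fin (n + 1)) (hc : c a₀ = 0)
  (ha₀ : genericPoint Z ∈ ZH ι (MvPolynomial.X a₀)) (hℓ : ∀ j, genericPoint Z ∈ ZH ι (ell c a₀ j))
  [Algebra A Z.functionField]
  (hAreg : ∀ (a : A) (y : Z), IsRegularAt y (algebraMap A Z.functionField a))
  (hA : ∀ a : A, algebraMap A Z.functionField a =
    ofSection (U := ⊤) (Set.mem_univ _) ((ι ≫ toSpec A n).appTop ((Scheme.ΓSpecIso (.of A)).inv a)))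
  {V : Scheme.{u}} [IsIntegral V] (q : V ⟶ Spec (.of A)) [IsSeparated q] (π : Z ⟶ V) [IsDominant π]
  (hι : ι ≫ toSpec A n = π ≫ q)

/-- The `Γ(U, 𝒪_V)`-algebra structure on `K(Z)` through `π^* : K(V) → K(Z)` (`U ≠ ∅`). A `def`,
activated with `letI`. [folklore] -/
abbrev secAlgebraZ (U : V.Opens) [Nonempty U] : Algebra Γ(V, U) Z.functionField :=
  ((functionFieldMap π).comp (algebraMap Γ(V, U) V.functionField)).toAlgebra

/-- The structure map of `secAlgebraZ`: `b ↦ π^*(b)` as a rational function, i.e. the rational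
function of the section `π^*(b) ∈ Γ(π⁻¹U, 𝒪_Z)`. [folklore] -/
theorem secAlgebraZ_algebraMap (U : V.Opens) [Nonempty U] (hU : genericPoint V ∈ U) (b : Γ(V, U)) :
    letI := secAlgebraZ π U
    algebraMap Γ(V, U) Z.functionField b = ofSection (genericPoint_mem_preimage π hU) (π.app U b) := by
  letI := secAlgebraZ π U
  change functionFieldMap π (ofSection hU b) = _
  rw [functionFieldMap_ofSection]

omit [IsClosedImmersion ι] [IsSeparated q] in
include hι hA in
/-- **Compatibility of the two scalar actions**: `A → Γ(U, 𝒪_V) → K(Z)` (through `q^*` and `π^*`) is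
the given `A`-algebra structure of `K(Z)` (through `ι` and `𝐏ⁿ_A → Spec A`). [folklore] -/
theorem isScalarTower_secAlgebraZ (U : V.Opens) [Nonempty U] (hU : genericPoint V ∈ U) :
    letI := SeparatedAffinePreimage.secAlgebra q U
    letI := secAlgebraZ π U
    IsScalarTower A Γ(V, U) Z.functionField := by
  letI := SeparatedAffinePreimage.secAlgebra q U
  letI := secAlgebraZ π U
  refine IsScalarTower.of_algebraMap_eq fun a => ?_
  rw [secAlgebraZ_algebraMap π U hU, hA]
  set s : Γ(V, ⊤) := q.appTop ((Scheme.ΓSpecIso (.of A)).inv a) with hs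
  have e1 : (ι ≫ toSpec A n).appTop ((Scheme.ΓSpecIso (.of A)).inv a) = π.appTop s := by
    rw [hι, Scheme.Hom.comp_appTop, CategoryTheory.ConcreteCategory.comp_apply]
  have e2 : algebraMap A Γ(V, U) a = V.presheaf.map (homOfLE (le_top : U ≤ ⊤)).op s := rfl
  have hnat := congrArg (fun φ => φ.hom s) (π.naturality (homOfLE (le_top : U ≤ ⊤)).op)
  simp only [CommRingCat.hom_comp, RingHom.coe_comp, Function.comp_apply] at hnat
  rw [e1, e2, hnat, ofSection_map]
  rfl

include hc hℓ hA hι in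
/-- **`Γ(π⁻¹U ∩ Z_{ℓ_t}, 𝒪_Z(dH)) = evFam Γ(U, 𝒪_V) θ 1 0 d t`** (`U ⊆ V` affine, `t ≠ ∅`): the
sections of the pointwise family `Pd d` over the affine `π⁻¹U ∩ Z_{ℓ_t}` are the evaluated family
over the ring `Γ(U, 𝒪_V)` acting through `π^*`. `⊇`: `Γ(U, 𝒪_V)` acts by functions regular on `π⁻¹U`.
`⊆`: a section is a finite sum `Σ r_i · π^*(b_i)` with `r_i ∈ Γ(Z_{ℓ_t}, 𝒪)`, `b_i ∈ Γ(U, 𝒪_V)`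
(`SeparatedAffinePreimage.exists_sum_res_mul_appLE`: the graph of `π` is a closed immersion), and
`evFam` commutes with the change of ring (`LaurentCech.evFam_eq_span_evFam`). This is
`Γ(U, π_*𝒪_Z(d)) = Γ(π⁻¹U, 𝒪_Z(d))` expressed through the graded module of `Z` (Görtz–Wedhorn II,
proof of Thm. 23.17 with Thm. 23.1). [cite: GortzWedhorn2023, Thm. 23.1 and Thm. 23.17 proof (pp. 412, 425)] -/
theorem secs_Pd_preimage_inf_eq {U : V.Opens} (hUaff : IsAffineOpen U) (hU : genericPoint V ∈ U)
    {t : Finset (Fin (n + 1))} (ht : t.Nonempty) (d : ℤ) :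
    haveI : Nonempty U := ⟨⟨_, hU⟩⟩
    letI := secAlgebraZ π U
    (PtFamily.secs (Pd ι c a₀ ha₀ hAreg d) (π ⁻¹ᵁ U ⊓ ZH ι (α c a₀ (Xs A t))) : Set Z.functionField) =
      (evFam Γ(V, U) (theta ι c a₀ ha₀) (isUnit_theta ι c a₀ ha₀ hℓ)
        (fun _ : Unit => (1 : Z.functionField)) (0 : Unit → ℤ) d t : Set Z.functionField) := by
  haveI : Nonempty U := ⟨⟨_, hU⟩⟩
  letI := SeparatedAffinePreimage.secAlgebra q U
  letI := secAlgebraZ π U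
  haveI := isScalarTower_secAlgebraZ ι hA q π hι U hU
  have hθ := isUnit_theta ι c a₀ ha₀ hℓ
  obtain ⟨k, hk⟩ := ht
  -- the regular functions `π^*(b)`
  have hbreg : ∀ (b : Γ(V, U)) (y : Z), y ∈ π ⁻¹ᵁ U →
      IsRegularAt y (algebraMap Γ(V, U) Z.functionField b) := fun b y hy => by
    rw [secAlgebraZ_algebraMap π U hU]
    exact isRegularAt_ofSection hy _
  rw [evFam_eq_span_evFam _ hθ _ _ A Γ(V, U), ← secs_Pd_eq_evFam ι c a₀ ha₀ hℓ hAreg hc hA ⟨k, hk⟩ d]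
  apply le_antisymm
  · -- `⊆`
    intro z hz
    have hz' := PtFamily.mem_secs.1 hz
    set Zt : Z.Opens := ZH ι (α c a₀ (Xs A t)) with hZt
    have hZtaff : IsAffineOpen Zt :=
      isAffineOpen_ZH ι (α_mem c a₀ (Xs_mem t)) (Finset.card_pos.2 ⟨k, hk⟩)
    have hξW : genericPoint Z ∈ Zt ⊓ π ⁻¹ᵁ U :=
      ⟨genericPoint_mem_ZH_α_Xs ι c a₀ hℓ t, genericPoint_mem_preimage π hU⟩
    -- `w = θ_k^{-d} z` is regular on `Z_t ∩ π⁻¹U`, hence a section there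
    have hwreg : ∀ y ∈ Zt ⊓ π ⁻¹ᵁ U, IsRegularAt y ((theta ι c a₀ ha₀ k ^ d)⁻¹ * z) := fun y hy =>
      (mem_Pd_iff_of_mem ι c a₀ ha₀ hℓ hAreg (ZH_α_Xs_le ι c a₀ hk hy.1)).1 (hz' y ⟨hy.2, hy.1⟩)
    obtain ⟨cw, hcw⟩ := exists_germ_eq_of_forall_isRegularAt hξW hwreg
    obtain ⟨S, hS⟩ := SeparatedAffinePreimage.exists_sum_res_mul_appLE π q hZtaff hUaff cw
    have hθk0 : theta ι c a₀ ha₀ k ^ d ≠ 0 := zpow_ne_zero d (hθ k).ne_zero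
    have hzeq : z = theta ι c a₀ ha₀ k ^ d * ofSection hξW cw := by
      rw [show ofSection hξW cw = (theta ι c a₀ ha₀ k ^ d)⁻¹ * z from hcw, ← mul_assoc,
        mul_inv_cancel₀ hθk0, one_mul]
    -- `res (π.appLE b) ↦ π^*(b)`
    have hb : ∀ b : Γ(V, U), ofSection hξW (π.appLE U (Zt ⊓ π ⁻¹ᵁ U) inf_le_right b) =
        algebraMap Γ(V, U) Z.functionField b := fun b => by
      rw [secAlgebraZ_algebraMap π U hU, Scheme.Hom.appLE, CategoryTheory.ConcreteCategory.comp_apply,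
        ofSection_map]
    have hsum : ofSection hξW cw = ∑ st ∈ S,
        ofSection (genericPoint_mem_ZH_α_Xs ι c a₀ hℓ t) st.1 * algebraMap Γ(V, U) Z.functionField st.2 := by
      rw [hS]
      refine (map_sum (Z.presheaf.germ (Zt ⊓ π ⁻¹ᵁ U) (genericPoint Z) hξW).hom _ S).trans
        (Finset.sum_congr rfl fun st _ => ?_)
      rw [map_mul, ← hb st.2]
      change ofSection hξW _ * ofSection hξW _ = _
      rw [ofSection_map]
    rw [hzeq, hsum, Finset.mul_sum]
    refine Submodule.sum_mem _ fun st _ => ?_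
    rw [show theta ι c a₀ ha₀ k ^ d * (ofSection (genericPoint_mem_ZH_α_Xs ι c a₀ hℓ t) st.1 *
        algebraMap Γ(V, U) Z.functionField st.2) =
        st.2 • (theta ι c a₀ ha₀ k ^ d * ofSection (genericPoint_mem_ZH_α_Xs ι c a₀ hℓ t) st.1) by
      rw [Algebra.smul_def]; ring]
    refine Submodule.smul_mem _ _ (Submodule.subset_span ?_)
    -- `θ_k^d · r ∈ Γ(Z_t, 𝒪(dH))`
    refine PtFamily.mem_secs.2 fun y hy => (mem_Pd_iff_of_mem ι c a₀ ha₀ hℓ hAreg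
      (ZH_α_Xs_le ι c a₀ hk hy)).2 ?_
    rw [← mul_assoc, inv_mul_cancel₀ hθk0, one_mul]
    exact isRegularAt_ofSection hy _
  · -- `⊇`
    intro z hz
    refine Submodule.span_induction (p := fun z _ => z ∈ (PtFamily.secs (Pd ι c a₀ ha₀ hAreg d)
      (π ⁻¹ᵁ U ⊓ ZH ι (α c a₀ (Xs A t))) : Set Z.functionField)) ?_ ?_ ?_ ?_ hz
    · intro w hw
      exact PtFamily.secs_anti _ inf_le_right hw
    · exact Submodule.zero_mem _
    · intro w w' _ _ hw hw'
      exact Submodule.add_mem _ hw hw'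
    · intro b w _ hw
      rw [Algebra.smul_def]
      exact PtFamily.mem_secs.2 fun y hy =>
        isRegularAt_mul_mem_Pd ι c a₀ ha₀ hAreg (hbreg b y hy.1) (PtFamily.mem_secs.1 hw y hy)

end Preimage

end ProjTwist

end Literature.AlgebraicGeometry.Motives

end
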